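import Summits.BirchSwinnertonDyer.BirchSwinnertonDyer.Theorems.ByReductionTypeAtTwoSlopePinchAlgebra
import HarnessLib

/-!
# Crux `SprungLowerDivisibilityAtThree` (K1, item stmt-BirchSwinnertonDyer-19875), line `chromatic-common-zeros`:
# the ROBUST BÉZOUT (approximate-resultant) LEMMA in `Λ = ℤ_p⟦T⟧` — a coprimality certificate that survives finite
# `p`-adic and `T`-adic precision (pure algebra, any prime `p`)

Cell `bsd-ssimc` (host), width seat `cruxlead-stmt-BirchSwinnertonDyer-19875-w2` (g4) under the 19875 lead;
`--supports` 19875 `--as helper`; THEOREMS ONLY (no definition, no named fact, nothing about any curve asserted);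
closes NO item. K1, Sprung's main conjecture, BSD and leaf X8 are NOT proved by anything here. The X8 per-pair doors
fed by this lemma are in the sibling file `…RobustBezoutDoor.lean`.

## Why

The exact Bézout door `ChromaticCommonZeros.lowerDivisibility_of_bezout` (an identity `a·L♯ + b·L♭ = C(p^k)` in `Λ`)
cannot be fed by data: Sprung's pair `(L♯, L♭)` is known only to finite `3`-adic precision and modulo `T^n` (finitely
many Mazur–Tate layers). The x8 cell certifies coprimality NUMERICALLY (a `3`-adic resultant of the distinguished
parts, R5 table); the kernel readings so far cover special shapes only (slope separation `λ♯ ≠ λ♭`, Eisenstein rigidity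
at `v₃ = 1`, chord / residual doors). Here: a Bézout identity that holds only MODULO `(p^{k+1}, T^n)` still forces
every common prime of `F, G` to contain `p`, provided `n ≥ (k+1)·λ(F)`.

## What is proved (namespace `…Theorems.ChromaticRobustBezout`)

* `mem_of_bezout_congr` (any commutative ring): `π` in the Jacobson radical, `𝔭` prime, `F, G ∈ 𝔭`,
  `a·F + b·G = π^k + E` with `E ∈ 𝔭 + (π^{k+1})` ⟹ `π ∈ 𝔭` (`π^k(1 + π·y) ∈ 𝔭`, `1 + π·y` a unit);
  `pow_mem_sup_pow` (`x ∈ I + J ⇒ x^n ∈ I + J^n`).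
* `X_pow_lam_mem_sup`: `F ≠ 0`, `μ(F) = 0`, `F ∈ I` ⟹ `T^{λ(F)} ∈ I + (p)` (`F = T^λ·V + Q`, `Q` the truncation below
  `λ` — divisible by `p`, `C_natCast_dvd_trunc_lam`, via `SlopePinch.p_dvd_coeff_of_lt_lam` — and `V(0) = F_λ ∈ ℤ_pˣ`); hence
  `X_pow_mem_sup_span_C_pow`: `m·λ(F) ≤ n ⟹ T^n ∈ I + (p^m)`.
* **`natCast_mem_of_robustBezout`**: `a·F + b·G − C(p^k) ∈ (C(p^{k+1}), T^n)`, `F ≠ 0`, `μ(F) = 0`, `(k+1)·λ(F) ≤ n`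
  ⟹ EVERY prime ideal of `Λ` containing `F` and `G` contains `p`. Contrapositives for `Spec Λ`:
  `not_mem_and_mem_of_robustBezout` / `…'` (normalisation read on `F` / on `G`), the `T`-shifted form
  `not_mem_and_mem_of_X_mul_of_robustBezout` (`F = T·F₁`, `G = T·G₁`, certificate for `(F₁, G₁)` ⟹ no common prime
  off `(p)` and `(T)`), the data-entry form `robustBezout_of_approx` (the congruence for `(F, G)` follows from the same
  congruence for ANY approximants `F₀ ≡ F`, `G₀ ≡ G (mod (C(p^{k+1}), T^n))` — a certificate computed from finitely
  many `p`-adic digits of finitely many coefficients is a kernel input valid for every congruent pair), and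
  `robustBezout_of_bezout` (an exact identity is a certificate for every `n`).
  Reading for data owners: a certified resultant `v_p(Res(P_F, P_G)) = k` at precision `≥ k+1` digits on the first
  `n ≥ (k+1)·λ` coefficients gives such a certificate (`Res = u·P_F + v·P_G`; divide by the Weierstrass units; truncate).

References: [Washington1997] §7.1 (Weierstrass preparation; `μ`, `λ`; proof of Thm. 7.3), §13.2; [Lang1990] Ch. 5 §2;
[AtiyahMacdonald1969] Prop. 1.9 (Jacobson radical and units); [KuriharaPollack2007] Problem 3.2; tree:
`…ByReductionTypeAtTwoSlopePinchAlgebra` (`SlopePinch.p_dvd_coeff_of_lt_lam`, `order_red_eq_lam`),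
`Rank1Residual/X1/MuLambdaAlgebra` (`mu`, `lam`, `red`, `red_eq_zero_iff`), `…BezoutDoor` (the exact door this lemma makes robust).
-/

set_option autoImplicit false
-- justification: the mandated namespace `Summit.BirchSwinnertonDyer.BirchSwinnertonDyer.Theorems`
-- (single-conjunct summit, Sub = Summit) repeats a segment by design (D-0017).
set_option linter.dupNamespace false

noncomputable section

open scoped Classical Polynomial

open Literature.NumberTheory.EllipticCurves
  Summit.BirchSwinnertonDyer.Rank1Residual.X1.MuLambda
  Summit.BirchSwinnertonDyer.BirchSwinnertonDyer.Theorems.SlopePinch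

/-! ### §1 The robust Bézout lemma in `Λ = ℤ_p⟦T⟧` (general `p`, pure algebra) -/

namespace Summit.BirchSwinnertonDyer.BirchSwinnertonDyer.Theorems.ChromaticRobustBezout

section CommRing

variable {R : Type*} [CommRing R]

/-- **Bézout modulo `(π^{k+1})` along a prime.** In a commutative ring, let `π` lie in the Jacobson radical and let
`𝔭` be a prime ideal containing `F` and `G`. If `a·F + b·G = π^k + E` with `E ∈ 𝔭 + (π^{k+1})`, then `π ∈ 𝔭`:
indeed `π^k·(1 + π·y) ∈ 𝔭` for some `y`, and `1 + π·y` is a unit. [cite: AtiyahMacdonald1969, Prop. 1.9] -/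
theorem mem_of_bezout_congr {π F G a b E : R} {𝔭 : Ideal R} (h𝔭 : 𝔭.IsPrime)
    (hπ : π ∈ (⊥ : Ideal R).jacobson) {k : ℕ} (hid : a * F + b * G = π ^ k + E)
    (hE : E ∈ 𝔭 ⊔ Ideal.span {π ^ (k + 1)}) (hF : F ∈ 𝔭) (hG : G ∈ 𝔭) : π ∈ 𝔭 := by
  obtain ⟨q, hq, e, he, hqe⟩ := Submodule.mem_sup.mp hE
  obtain ⟨y, rfl⟩ := Ideal.mem_span_singleton'.mp he
  have hsum : π ^ k + E ∈ 𝔭 := by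
    rw [← hid]
    exact 𝔭.add_mem (𝔭.mul_mem_left a hF) (𝔭.mul_mem_left b hG)
  have hmem : π ^ k * (1 + π * y) ∈ 𝔭 := by
    have h1 : π ^ k * (1 + π * y) = (π ^ k + E) - q := by rw [← hqe]; ring
    rw [h1]
    exact 𝔭.sub_mem hsum hq
  have hunit : IsUnit (1 + π * y) := by
    have h := Ideal.mem_jacobson_bot.mp hπ y
    rwa [add_comm] at h
  rcases h𝔭.mem_or_mem hmem with hk | hu
  · exact h𝔭.mem_of_pow_mem k hk
  · exact absurd (Ideal.eq_top_of_isUnit_mem _ hu hunit) h𝔭.ne_top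

/-- Powers along a sum of ideals: `x ∈ I + J ⇒ x^n ∈ I + J^n` (binomial expansion; every term with an `I`-factor lies
in `I`). [folklore] -/
theorem pow_mem_sup_pow {I J : Ideal R} {x : R} (hx : x ∈ I ⊔ J) (n : ℕ) : x ^ n ∈ I ⊔ J ^ n := by
  obtain ⟨i, hi, j, hj, rfl⟩ := Submodule.mem_sup.mp hx
  induction n with
  | zero =>
    simp only [pow_zero, Ideal.one_eq_top, le_top, sup_of_le_right, Submodule.mem_top]
  | succ n ih =>
    obtain ⟨i', hi', j', hj', hij⟩ := Submodule.mem_sup.mp ih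
    have h1 : (i + j) ^ (n + 1) = (i' * (i + j) + j' * i) + j' * j := by
      rw [pow_succ, ← hij]; ring
    rw [h1]
    refine Submodule.mem_sup.mpr ⟨i' * (i + j) + j' * i, ?_, j' * j, ?_, rfl⟩
    · exact I.add_mem (I.mul_mem_right _ hi') (I.mul_mem_left _ hi)
    · rw [pow_succ]
      exact Ideal.mul_mem_mul hj' hj

end CommRing

section Lambda

variable {p : ℕ} [hp : Fact p.Prime]

/-- `p` (as an element of `Λ = ℤ_p⟦T⟧`) lies in the Jacobson radical: `Λ` is local and `p` is not a unit.
[cite: Washington1997, §7.1] -/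
theorem natCast_mem_jacobson_bot : ((p : ℕ) : IwasawaAlgebra p) ∈ (⊥ : Ideal (IwasawaAlgebra p)).jacobson := by
  rw [IsLocalRing.jacobson_eq_maximalIdeal ⊥ bot_ne_top, IsLocalRing.mem_maximalIdeal, mem_nonunits_iff]
  intro hu
  have h0 := PowerSeries.isUnit_constantCoeff _ hu
  rw [map_natCast] at h0
  exact PadicInt.irreducible_p.not_isUnit h0

/-- `C(p^m) = p^m` in `Λ`. [folklore] -/
theorem C_natCast_pow (m : ℕ) :
    (PowerSeries.C ((p : ℤ_[p]) ^ m) : IwasawaAlgebra p) = ((p : ℕ) : IwasawaAlgebra p) ^ m := by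
  rw [map_pow, map_natCast]

/-- The truncation of `F` below `λ(F)` is divisible by `p` (all its coefficients are). [cite: Washington1997, §7.1] -/
theorem C_natCast_dvd_trunc_lam {F : IwasawaAlgebra p} (hF : F ≠ 0) (hμ : mu F = 0) :
    (PowerSeries.C (p : ℤ_[p]) : IwasawaAlgebra p) ∣ ((PowerSeries.trunc (lam F) F : ℤ_[p][X]) : PowerSeries ℤ_[p]) := by
  rw [← red_eq_zero_iff]
  ext m
  rw [PowerSeries.coeff_map, map_zero, Polynomial.coeff_coe, PowerSeries.coeff_trunc]
  split_ifs with hm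
  · obtain ⟨c, hc⟩ := p_dvd_coeff_of_lt_lam hF hμ hm
    rw [hc, IsLocalRing.residue_eq_zero_iff, PadicInt.maximalIdeal_eq_span_p]
    exact Ideal.mul_mem_right _ _ (Ideal.mem_span_singleton_self _)
  · exact map_zero _

/-- **`T^{λ(F)} ∈ I + (p)` for every ideal `I ∋ F`** (`F ≠ 0`, `μ(F) = 0`): write `F = T^λ·V + Q` with `Q` the truncation
of `F` below `λ` (divisible by `p`) and `V(0) = F_λ` a unit, so `T^λ = V⁻¹·(F − Q)`.
[cite: Washington1997, §7.1 (proof of Thm. 7.3)] -/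
theorem X_pow_lam_mem_sup {F : IwasawaAlgebra p} (hF : F ≠ 0) (hμ : mu F = 0) {I : Ideal (IwasawaAlgebra p)}
    (hFI : F ∈ I) :
    (PowerSeries.X : IwasawaAlgebra p) ^ lam F ∈ I ⊔ Ideal.span {(PowerSeries.C (p : ℤ_[p]) : IwasawaAlgebra p)} := by
  set l := lam F with hl
  set Q : IwasawaAlgebra p := ((PowerSeries.trunc l F : ℤ_[p][X]) : PowerSeries ℤ_[p]) with hQ
  set V : IwasawaAlgebra p := PowerSeries.mk fun i => PowerSeries.coeff (i + l) F with hV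
  have hdec : F = PowerSeries.X ^ l * V + Q := PowerSeries.eq_X_pow_mul_shift_add_trunc l F
  -- `V` is a unit: its constant coefficient is `F_λ`, a unit since `λ(F)` is the order of `F mod p`
  -- (`SlopePinch.order_red_eq_lam`; cf. `TwoAdicTwistConverse.isUnit_coeff_lam_of_mu_eq_zero`)
  have hVu : IsUnit V := by
    rw [PowerSeries.isUnit_iff_constantCoeff]
    have h0 : PowerSeries.constantCoeff V = PowerSeries.coeff l F := by
      rw [← PowerSeries.coeff_zero_eq_constantCoeff_apply, hV, PowerSeries.coeff_mk, zero_add]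
    rw [h0]
    obtain ⟨-, hred⟩ := pfree_eq_self_of_mu_eq_zero hF hμ
    have hc : PowerSeries.coeff l (red F) ≠ 0 := by
      have h := PowerSeries.coeff_order hred
      have hn : (red F).order.toNat = l := by
        rw [order_red_eq_lam hF hμ]; simp [hl]
      rwa [hn] at h
    rw [PowerSeries.coeff_map] at hc
    by_contra hnu
    exact hc ((IsLocalRing.residue_eq_zero_iff _).mpr ((IsLocalRing.mem_maximalIdeal _).mpr hnu))
  obtain ⟨u, hu⟩ := hVu
  -- `Q ∈ (p)`
  have hQmem : Q ∈ Ideal.span {(PowerSeries.C (p : ℤ_[p]) : IwasawaAlgebra p)} :=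
    Ideal.mem_span_singleton.mpr (C_natCast_dvd_trunc_lam hF hμ)
  -- `T^λ·V = F − Q ∈ I + (p)`
  have hXV : PowerSeries.X ^ l * V ∈ I ⊔ Ideal.span {(PowerSeries.C (p : ℤ_[p]) : IwasawaAlgebra p)} := by
    have h1 : PowerSeries.X ^ l * V = F - Q := by rw [hdec]; ring
    rw [h1]
    exact Ideal.sub_mem _ (Ideal.mem_sup_left hFI) (Ideal.mem_sup_right hQmem)
  have h2 : (PowerSeries.X : IwasawaAlgebra p) ^ l = (PowerSeries.X ^ l * V) * ((u⁻¹ : (IwasawaAlgebra p)ˣ) : IwasawaAlgebra p) := by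
    rw [← hu, mul_assoc, Units.mul_inv, mul_one]
  rw [h2]
  exact Ideal.mul_mem_right _ _ hXV

/-- **`T^n ∈ I + (p^m)` whenever `m·λ(F) ≤ n`** for an ideal `I ∋ F` (`F ≠ 0`, `μ(F) = 0`): raise `T^λ ∈ I + (p)` to the
`m`-th power. [cite: Washington1997, §7.1] -/
theorem X_pow_mem_sup_span_C_pow {F : IwasawaAlgebra p} (hF : F ≠ 0) (hμ : mu F = 0)
    {I : Ideal (IwasawaAlgebra p)} (hFI : F ∈ I) {m n : ℕ} (hn : m * lam F ≤ n) :
    (PowerSeries.X : IwasawaAlgebra p) ^ n ∈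
      I ⊔ Ideal.span {(PowerSeries.C ((p : ℤ_[p]) ^ m) : IwasawaAlgebra p)} := by
  have h1 := pow_mem_sup_pow (X_pow_lam_mem_sup hF hμ hFI) m
  rw [Ideal.span_singleton_pow, ← map_pow, ← pow_mul, mul_comm] at h1
  obtain ⟨d, hd⟩ := Nat.exists_eq_add_of_le hn
  rw [hd, pow_add]
  exact Ideal.mul_mem_right _ _ h1

/-- **THE ROBUST BÉZOUT LEMMA.** Let `F, G, a, b ∈ Λ = ℤ_p⟦T⟧` and `k, n ∈ ℕ` with
`a·F + b·G − C(p^k) ∈ (C(p^{k+1}), T^n)`, `F ≠ 0`, `μ(F) = 0` and `(k+1)·λ(F) ≤ n`. Then every prime ideal of `Λ`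
containing `F` and `G` contains `p`. Proof: `T^n ∈ 𝔭 + (p^{k+1})`, so `a·F + b·G = p^k + E` with `E ∈ 𝔭 + (p^{k+1})`;
conclude by `mem_of_bezout_congr`. [cite: Washington1997, §7.1 and §13.2] [cite: AtiyahMacdonald1969, Prop. 1.9] -/
theorem natCast_mem_of_robustBezout {F G a b : IwasawaAlgebra p} {k n : ℕ} (hF : F ≠ 0) (hμ : mu F = 0)
    (hn : (k + 1) * lam F ≤ n)
    (hcert : a * F + b * G - PowerSeries.C ((p : ℤ_[p]) ^ k) ∈
      Ideal.span {(PowerSeries.C ((p : ℤ_[p]) ^ (k + 1)) : IwasawaAlgebra p), PowerSeries.X ^ n})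
    {𝔭 : Ideal (IwasawaAlgebra p)} (h𝔭 : 𝔭.IsPrime) (hF𝔭 : F ∈ 𝔭) (hG𝔭 : G ∈ 𝔭) :
    ((p : ℕ) : IwasawaAlgebra p) ∈ 𝔭 := by
  set E := a * F + b * G - PowerSeries.C ((p : ℤ_[p]) ^ k) with hEdef
  have hid : a * F + b * G = ((p : ℕ) : IwasawaAlgebra p) ^ k + E := by
    rw [hEdef, C_natCast_pow]; ring
  have hXn := X_pow_mem_sup_span_C_pow hF hμ hF𝔭 hn
  have hE : E ∈ 𝔭 ⊔ Ideal.span {((p : ℕ) : IwasawaAlgebra p) ^ (k + 1)} := by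
    rw [← C_natCast_pow]
    obtain ⟨c, z, hz, hcz⟩ := Ideal.mem_span_insert.mp hcert
    obtain ⟨d, rfl⟩ := Ideal.mem_span_singleton'.mp hz
    rw [hcz]
    refine Ideal.add_mem _ (Ideal.mem_sup_right ?_) (Ideal.mul_mem_left _ d hXn)
    exact Ideal.mul_mem_left _ c (Ideal.mem_span_singleton_self _)
  exact mem_of_bezout_congr h𝔭 natCast_mem_jacobson_bot hid hE hF𝔭 hG𝔭

/-- **No common prime off `(p)`** under a robust Bézout certificate (contrapositive of `natCast_mem_of_robustBezout`,
for points of `Spec Λ`). [cite: Washington1997, §13.2] -/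
theorem not_mem_and_mem_of_robustBezout {F G a b : IwasawaAlgebra p} {k n : ℕ} (hF : F ≠ 0) (hμ : mu F = 0)
    (hn : (k + 1) * lam F ≤ n)
    (hcert : a * F + b * G - PowerSeries.C ((p : ℤ_[p]) ^ k) ∈
      Ideal.span {(PowerSeries.C ((p : ℤ_[p]) ^ (k + 1)) : IwasawaAlgebra p), PowerSeries.X ^ n})
    (𝔭 : PrimeSpectrum (IwasawaAlgebra p)) (hp𝔭 : ((p : ℕ) : IwasawaAlgebra p) ∉ 𝔭.asIdeal) :
    ¬ (F ∈ 𝔭.asIdeal ∧ G ∈ 𝔭.asIdeal) := fun h =>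
  hp𝔭 (natCast_mem_of_robustBezout hF hμ hn hcert 𝔭.isPrime h.1 h.2)

/-- The same with the roles of `F` and `G` exchanged in the certificate (the `μ`/`λ` normalisation is read on `G`).
[cite: Washington1997, §13.2] -/
theorem not_mem_and_mem_of_robustBezout' {F G a b : IwasawaAlgebra p} {k n : ℕ} (hG : G ≠ 0) (hμ : mu G = 0)
    (hn : (k + 1) * lam G ≤ n)
    (hcert : a * F + b * G - PowerSeries.C ((p : ℤ_[p]) ^ k) ∈
      Ideal.span {(PowerSeries.C ((p : ℤ_[p]) ^ (k + 1)) : IwasawaAlgebra p), PowerSeries.X ^ n})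
    (𝔭 : PrimeSpectrum (IwasawaAlgebra p)) (hp𝔭 : ((p : ℕ) : IwasawaAlgebra p) ∉ 𝔭.asIdeal) :
    ¬ (F ∈ 𝔭.asIdeal ∧ G ∈ 𝔭.asIdeal) := by
  have hcert' : b * G + a * F - PowerSeries.C ((p : ℤ_[p]) ^ k) ∈
      Ideal.span {(PowerSeries.C ((p : ℤ_[p]) ^ (k + 1)) : IwasawaAlgebra p), PowerSeries.X ^ n} := by
    rw [add_comm (b * G)]; exact hcert
  exact fun h => not_mem_and_mem_of_robustBezout hG hμ hn hcert' 𝔭 hp𝔭 ⟨h.2, h.1⟩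

/-- **`T`-shifted form** (analytic rank one): if `F = T·F₁`, `G = T·G₁` and `(F₁, G₁)` carries a robust Bézout
certificate, then no prime off `(p)` and off `(T)` contains both `F` and `G`. [cite: Washington1997, §13.2] -/
theorem not_mem_and_mem_of_X_mul_of_robustBezout {F G F₁ G₁ a b : IwasawaAlgebra p} {k n : ℕ}
    (hFF : F = PowerSeries.X * F₁) (hGG : G = PowerSeries.X * G₁) (hF₁ : F₁ ≠ 0) (hμ : mu F₁ = 0)
    (hn : (k + 1) * lam F₁ ≤ n)
    (hcert : a * F₁ + b * G₁ - PowerSeries.C ((p : ℤ_[p]) ^ k) ∈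
      Ideal.span {(PowerSeries.C ((p : ℤ_[p]) ^ (k + 1)) : IwasawaAlgebra p), PowerSeries.X ^ n})
    (𝔭 : PrimeSpectrum (IwasawaAlgebra p)) (hp𝔭 : ((p : ℕ) : IwasawaAlgebra p) ∉ 𝔭.asIdeal)
    (hT : (PowerSeries.X : IwasawaAlgebra p) ∉ 𝔭.asIdeal) :
    ¬ (F ∈ 𝔭.asIdeal ∧ G ∈ 𝔭.asIdeal) := by
  rintro ⟨hFm, hGm⟩
  rw [hFF] at hFm
  rw [hGG] at hGm
  have hF₁m : F₁ ∈ 𝔭.asIdeal := (𝔭.isPrime.mem_or_mem hFm).resolve_left hT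
  have hG₁m : G₁ ∈ 𝔭.asIdeal := (𝔭.isPrime.mem_or_mem hGm).resolve_left hT
  exact not_mem_and_mem_of_robustBezout hF₁ hμ hn hcert 𝔭 hp𝔭 ⟨hF₁m, hG₁m⟩

/-- **Data entry.** The robust Bézout congruence for `(F, G)` follows from the same congruence for approximants
`F₀, G₀` with `F ≡ F₀`, `G ≡ G₀ (mod (C(p^{k+1}), T^n))`: `a·F + b·G − p^k = a·(F − F₀) + b·(G − G₀) + (a·F₀ + b·G₀ − p^k)`.
So a certificate computed from `F₀, G₀` (finitely many `p`-adic digits of finitely many coefficients) applies to EVERY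
pair congruent to them. [folklore] -/
theorem robustBezout_of_approx {F G F₀ G₀ a b : IwasawaAlgebra p} {k n : ℕ}
    (hF : F - F₀ ∈ Ideal.span {(PowerSeries.C ((p : ℤ_[p]) ^ (k + 1)) : IwasawaAlgebra p), PowerSeries.X ^ n})
    (hG : G - G₀ ∈ Ideal.span {(PowerSeries.C ((p : ℤ_[p]) ^ (k + 1)) : IwasawaAlgebra p), PowerSeries.X ^ n})
    (hcert₀ : a * F₀ + b * G₀ - PowerSeries.C ((p : ℤ_[p]) ^ k) ∈
      Ideal.span {(PowerSeries.C ((p : ℤ_[p]) ^ (k + 1)) : IwasawaAlgebra p), PowerSeries.X ^ n}) :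
    a * F + b * G - PowerSeries.C ((p : ℤ_[p]) ^ k) ∈
      Ideal.span {(PowerSeries.C ((p : ℤ_[p]) ^ (k + 1)) : IwasawaAlgebra p), PowerSeries.X ^ n} := by
  have h1 : a * F + b * G - PowerSeries.C ((p : ℤ_[p]) ^ k) =
      a * (F - F₀) + b * (G - G₀) + (a * F₀ + b * G₀ - PowerSeries.C ((p : ℤ_[p]) ^ k)) := by ring
  rw [h1]
  exact Ideal.add_mem _ (Ideal.add_mem _ (Ideal.mul_mem_left _ a hF) (Ideal.mul_mem_left _ b hG)) hcert₀

/-- The EXACT Bézout identity `a·F + b·G = C(p^k)` is a robust certificate for every `n` (error `0`); so this door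
contains the exact door `ChromaticCommonZeros.lowerDivisibility_of_bezout`. [folklore] -/
theorem robustBezout_of_bezout {F G a b : IwasawaAlgebra p} {k : ℕ} (n : ℕ)
    (hbez : a * F + b * G = PowerSeries.C ((p : ℤ_[p]) ^ k)) :
    a * F + b * G - PowerSeries.C ((p : ℤ_[p]) ^ k) ∈
      Ideal.span {(PowerSeries.C ((p : ℤ_[p]) ^ (k + 1)) : IwasawaAlgebra p), PowerSeries.X ^ n} := by
  rw [hbez, sub_self]
  exact Ideal.zero_mem _

end Lambda

/-! ### §1b (APPEND, w2 g4) GRADED PRECISION: the certificate ideal `J^{k+1}`, `J = (p, T^λ)`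
Since `T^λ ∈ 𝔭 + (p)` for every prime `𝔭 ∋ F`, `J ⊆ 𝔭 + (p)` and `J^{k+1} ⊆ 𝔭 + (p^{k+1})`: the certificate may be read
modulo `J^{k+1} = (p^{k+1}, p^k T^λ, …, T^{(k+1)λ})`, i.e. coefficient `i` of `a·F + b·G − p^k` (and of the errors
`F − F₀`, `G − G₀`) needs only `k+1−⌊i/λ⌋` exact digits — a budget decreasing in blocks of `λ`, as the precision of the
reconstructed pair does along the Mazur–Tate tower. The box ideal `(p^{k+1}, T^n)`, `n ≥ (k+1)λ`, lies in `J^{k+1}`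
(`span_C_pow_X_pow_le_certIdeal`), so §1 is the special case. -/

section Graded

variable {R : Type*} [CommRing R]

/-- `(I + K)^n ⊆ I + K^n` for ideals (every product with an `I`-factor lies in `I`). [folklore] -/
theorem sup_pow_le_sup_pow (I K : Ideal R) (n : ℕ) : (I ⊔ K) ^ n ≤ I ⊔ K ^ n := by
  induction n with
  | zero => simp
  | succ n ih =>
    rw [pow_succ, pow_succ]
    calc (I ⊔ K) ^ n * (I ⊔ K) ≤ (I ⊔ K ^ n) * (I ⊔ K) := Ideal.mul_mono_left ih
      _ = (I ⊔ K ^ n) * I ⊔ (I ⊔ K ^ n) * K := Ideal.mul_sup _ _ _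
      _ ≤ I ⊔ K ^ n * K := by
          refine sup_le (le_sup_of_le_left Ideal.mul_le_left) ?_
          rw [Ideal.sup_mul]
          exact sup_le (le_sup_of_le_left Ideal.mul_le_right) le_sup_right

variable {p : ℕ} [hp : Fact p.Prime]

/-- **The graded certificate ideal** `(p, T^l)^{k+1}` lies in `𝔭 + (p^{k+1})` as soon as `T^l ∈ 𝔭 + (p)` (in particular
for `l = λ(F)`, `F ∈ 𝔭`, by `X_pow_lam_mem_sup`). [cite: Washington1997, §7.1] -/
theorem certIdeal_pow_le_sup {I : Ideal (IwasawaAlgebra p)} {l : ℕ}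
    (hX : (PowerSeries.X : IwasawaAlgebra p) ^ l ∈ I ⊔ Ideal.span {(PowerSeries.C (p : ℤ_[p]) : IwasawaAlgebra p)})
    (m : ℕ) :
    (Ideal.span {(PowerSeries.C (p : ℤ_[p]) : IwasawaAlgebra p), PowerSeries.X ^ l}) ^ m ≤
      I ⊔ Ideal.span {(PowerSeries.C ((p : ℤ_[p]) ^ m) : IwasawaAlgebra p)} := by
  have hJ : Ideal.span {(PowerSeries.C (p : ℤ_[p]) : IwasawaAlgebra p), PowerSeries.X ^ l} ≤
      I ⊔ Ideal.span {(PowerSeries.C (p : ℤ_[p]) : IwasawaAlgebra p)} := by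
    rw [Ideal.span_insert]
    exact sup_le (le_sup_of_le_right le_rfl) ((Ideal.span_singleton_le_iff_mem _).mpr hX)
  calc (Ideal.span {(PowerSeries.C (p : ℤ_[p]) : IwasawaAlgebra p), PowerSeries.X ^ l}) ^ m
      ≤ (I ⊔ Ideal.span {(PowerSeries.C (p : ℤ_[p]) : IwasawaAlgebra p)}) ^ m := Ideal.pow_right_mono hJ m
    _ ≤ I ⊔ (Ideal.span {(PowerSeries.C (p : ℤ_[p]) : IwasawaAlgebra p)}) ^ m := sup_pow_le_sup_pow _ _ m
    _ = I ⊔ Ideal.span {(PowerSeries.C ((p : ℤ_[p]) ^ m) : IwasawaAlgebra p)} := by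
        rw [Ideal.span_singleton_pow, map_pow]

/-- **THE GRADED ROBUST BÉZOUT LEMMA.** If `a·F + b·G − C(p^k) ∈ (C(p), T^{λ(F)})^{k+1}` (coefficient `i` of the error
vanishes modulo `p^{k+1−⌊i/λ(F)⌋}`), `F ≠ 0`, `μ(F) = 0`, then every prime ideal of `Λ` containing `F` and `G` contains
`p`. [cite: Washington1997, §7.1 and §13.2] [cite: AtiyahMacdonald1969, Prop. 1.9] -/
theorem natCast_mem_of_gradedBezout {F G a b : IwasawaAlgebra p} {k : ℕ} (hF : F ≠ 0) (hμ : mu F = 0)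
    (hcert : a * F + b * G - PowerSeries.C ((p : ℤ_[p]) ^ k) ∈
      (Ideal.span {(PowerSeries.C (p : ℤ_[p]) : IwasawaAlgebra p), PowerSeries.X ^ lam F}) ^ (k + 1))
    {𝔭 : Ideal (IwasawaAlgebra p)} (h𝔭 : 𝔭.IsPrime) (hF𝔭 : F ∈ 𝔭) (hG𝔭 : G ∈ 𝔭) :
    ((p : ℕ) : IwasawaAlgebra p) ∈ 𝔭 := by
  set E := a * F + b * G - PowerSeries.C ((p : ℤ_[p]) ^ k) with hEdef
  have hid : a * F + b * G = ((p : ℕ) : IwasawaAlgebra p) ^ k + E := by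
    rw [hEdef, C_natCast_pow]; ring
  have hE : E ∈ 𝔭 ⊔ Ideal.span {((p : ℕ) : IwasawaAlgebra p) ^ (k + 1)} := by
    rw [← C_natCast_pow]
    exact certIdeal_pow_le_sup (X_pow_lam_mem_sup hF hμ hF𝔭) (k + 1) hcert
  exact mem_of_bezout_congr h𝔭 natCast_mem_jacobson_bot hid hE hF𝔭 hG𝔭

/-- **No common prime off `(p)`** under a graded certificate (normalisation read on `F`). [cite: Washington1997, §13.2] -/
theorem not_mem_and_mem_of_gradedBezout {F G a b : IwasawaAlgebra p} {k : ℕ} (hF : F ≠ 0) (hμ : mu F = 0)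
    (hcert : a * F + b * G - PowerSeries.C ((p : ℤ_[p]) ^ k) ∈
      (Ideal.span {(PowerSeries.C (p : ℤ_[p]) : IwasawaAlgebra p), PowerSeries.X ^ lam F}) ^ (k + 1))
    (𝔭 : PrimeSpectrum (IwasawaAlgebra p)) (hp𝔭 : ((p : ℕ) : IwasawaAlgebra p) ∉ 𝔭.asIdeal) :
    ¬ (F ∈ 𝔭.asIdeal ∧ G ∈ 𝔭.asIdeal) := fun h =>
  hp𝔭 (natCast_mem_of_gradedBezout hF hμ hcert 𝔭.isPrime h.1 h.2)

/-- **`T`-shifted graded form** (analytic rank one): `F = T·F₁`, `G = T·G₁`, graded certificate for `(F₁, G₁)` ⟹ no prime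
off `(p)` and `(T)` contains both `F` and `G`. [cite: Washington1997, §13.2] -/
theorem not_mem_and_mem_of_X_mul_of_gradedBezout {F G F₁ G₁ a b : IwasawaAlgebra p} {k : ℕ}
    (hFF : F = PowerSeries.X * F₁) (hGG : G = PowerSeries.X * G₁) (hF₁ : F₁ ≠ 0) (hμ : mu F₁ = 0)
    (hcert : a * F₁ + b * G₁ - PowerSeries.C ((p : ℤ_[p]) ^ k) ∈
      (Ideal.span {(PowerSeries.C (p : ℤ_[p]) : IwasawaAlgebra p), PowerSeries.X ^ lam F₁}) ^ (k + 1))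
    (𝔭 : PrimeSpectrum (IwasawaAlgebra p)) (hp𝔭 : ((p : ℕ) : IwasawaAlgebra p) ∉ 𝔭.asIdeal)
    (hT : (PowerSeries.X : IwasawaAlgebra p) ∉ 𝔭.asIdeal) :
    ¬ (F ∈ 𝔭.asIdeal ∧ G ∈ 𝔭.asIdeal) := by
  rintro ⟨hFm, hGm⟩
  rw [hFF] at hFm
  rw [hGG] at hGm
  exact not_mem_and_mem_of_gradedBezout hF₁ hμ hcert 𝔭 hp𝔭
    ⟨(𝔭.isPrime.mem_or_mem hFm).resolve_left hT, (𝔭.isPrime.mem_or_mem hGm).resolve_left hT⟩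

/-- **Graded data entry**: the graded congruence for `(F, G)` follows from the same one for approximants `F₀ ≡ F`,
`G₀ ≡ G (mod (p, T^l)^{k+1})` — coefficient `i` of `F` needs only `k+1−⌊i/l⌋` exact digits. [folklore] -/
theorem gradedBezout_of_approx {F G F₀ G₀ a b : IwasawaAlgebra p} {k l : ℕ}
    (hF : F - F₀ ∈ (Ideal.span {(PowerSeries.C (p : ℤ_[p]) : IwasawaAlgebra p), PowerSeries.X ^ l}) ^ (k + 1))
    (hG : G - G₀ ∈ (Ideal.span {(PowerSeries.C (p : ℤ_[p]) : IwasawaAlgebra p), PowerSeries.X ^ l}) ^ (k + 1))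
    (hcert₀ : a * F₀ + b * G₀ - PowerSeries.C ((p : ℤ_[p]) ^ k) ∈
      (Ideal.span {(PowerSeries.C (p : ℤ_[p]) : IwasawaAlgebra p), PowerSeries.X ^ l}) ^ (k + 1)) :
    a * F + b * G - PowerSeries.C ((p : ℤ_[p]) ^ k) ∈
      (Ideal.span {(PowerSeries.C (p : ℤ_[p]) : IwasawaAlgebra p), PowerSeries.X ^ l}) ^ (k + 1) := by
  have h1 : a * F + b * G - PowerSeries.C ((p : ℤ_[p]) ^ k) =
      a * (F - F₀) + b * (G - G₀) + (a * F₀ + b * G₀ - PowerSeries.C ((p : ℤ_[p]) ^ k)) := by ring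
  rw [h1]
  exact Ideal.add_mem _ (Ideal.add_mem _ (Ideal.mul_mem_left _ a hF) (Ideal.mul_mem_left _ b hG)) hcert₀

/-- The box certificate ideal lies in the graded one: `(C(p^{k+1}), T^n) ⊆ (C(p), T^l)^{k+1}` if `(k+1)·l ≤ n`. [folklore] -/
theorem span_C_pow_X_pow_le_certIdeal {k l n : ℕ} (hn : (k + 1) * l ≤ n) :
    Ideal.span {(PowerSeries.C ((p : ℤ_[p]) ^ (k + 1)) : IwasawaAlgebra p), PowerSeries.X ^ n} ≤
      (Ideal.span {(PowerSeries.C (p : ℤ_[p]) : IwasawaAlgebra p), PowerSeries.X ^ l}) ^ (k + 1) := by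
  set J := Ideal.span {(PowerSeries.C (p : ℤ_[p]) : IwasawaAlgebra p), PowerSeries.X ^ l} with hJ
  have hCp : (PowerSeries.C (p : ℤ_[p]) : IwasawaAlgebra p) ∈ J := Ideal.subset_span (by simp)
  have hXl : (PowerSeries.X : IwasawaAlgebra p) ^ l ∈ J := Ideal.subset_span (by simp)
  rw [Ideal.span_insert, sup_le_iff, Ideal.span_singleton_le_iff_mem, Ideal.span_singleton_le_iff_mem]
  refine ⟨?_, ?_⟩
  · rw [map_pow]
    exact Ideal.pow_mem_pow hCp (k + 1)
  · obtain ⟨d, hd⟩ := Nat.exists_eq_add_of_le hn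
    have h1 : (PowerSeries.X : IwasawaAlgebra p) ^ n = (PowerSeries.X ^ l) ^ (k + 1) * PowerSeries.X ^ d := by
      rw [hd, pow_add, ← pow_mul, mul_comm l (k + 1)]
    rw [h1]
    exact Ideal.mul_mem_right _ _ (Ideal.pow_mem_pow hXl (k + 1))

end Graded

end Summit.BirchSwinnertonDyer.BirchSwinnertonDyer.Theorems.ChromaticRobustBezout

end
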